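import Literature.AlgebraicGeometry.Motives.MixedHodgeStructureInternalHomFiltrations
import HarnessLib

/-!
# `Hom_MHS(ℚ(-p), H) = Hdgᵖ(H)`: morphisms from the Tate structures are the Hodge classes

D. Arapura, *Hodge cycles and the Leray filtration* (Pacific J. Math. 319 (2022)), §1: "Given a mixed
Hodge structure `H`, set `Hodge(H) := Hom_MHS(ℚ(0), H)`"; the tree's `MixedHodgeStructure.hodgeClasses H p`
(`Motives/MixedHodgeStructureHodgeClasses`: the rational `v ∈ W_{2p}` with `1 ⊗ v ∈ Fᵖ`) is documented as
"the images of `1` under the morphisms `ℚ(-p) → H`". This file makes the identification formal: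

* **`tateHomEquivHodgeClasses H p : Hom ℚ(-p) H ≃ Hdgᵖ(H)`**, `f ↦ f(1)`, inverse `v ↦ (q ↦ q • v)`
  (`ℚ(-p)` = the tree's `(HodgeStructure.tate (-p)).toMixedHodgeStructure`, pure of weight `2p` and
  type `(p, p)`: `W_{2p-1} = 0`, `W_{2p} = ℚ`, `Fᵖ = ℂ`, `F^{p+1} = 0`);
* **`unitHomHomEquiv : Hom_MHS(ℚ(0), Hom(H₁, H₂)) ≃ Hom_MHS(H₁, H₂)`** — Deligne–Milne, *Tannakian
  categories*, §1 (1.6.4): "`Hom(1, Hom(X, Y)) = Hom(1 ⊗ X, Y) = Hom(X, Y)`", obtained from the `(0,0)`-classes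
  of the internal Hom (`homEquivHodgeClasses`, `Motives/MixedHodgeStructureInternalHomFiltrations`).

Definitions with bodies (`Equiv`s, morphisms) and theorems; no named fact is introduced.

## References

* [Arapura2022] D. Arapura, Hodge cycles and the Leray filtration, Pacific J. Math. 319 (2022), §1
  (held text `paper:arxiv-2103.05038`, p. 3).
* [DeligneMilne1982Tannakian] P. Deligne, J. S. Milne, Tannakian categories, LNM 900, §1 (1.6.4).
* [DeligneHodgeII1971] P. Deligne, Théorie de Hodge II, 2.1.13 (Tate structure), 2.3.1.
-/

noncomputable section

open scoped TensorProduct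

namespace Literature.AlgebraicGeometry.Motives

namespace MixedHodgeStructure

universe u v

variable {V : Type u} [AddCommGroup V] [Module ℚ V]
variable {V' : Type v} [AddCommGroup V'] [Module ℚ V']

open Module
open HodgeStructure (ofRat ofRat_apply)

/-! ### Morphisms `ℚ(-p) → H` -/

/-- The value at `1` of a morphism `ℚ(-p) → H` is a Hodge class of type `(p, p)`: `1 ∈ W_{2p} ℚ(-p)` and
`1 ⊗ 1 ∈ Fᵖ ℚ(-p)_ℂ`, so `f(1) ∈ W_{2p} H` and `1 ⊗ f(1) = f_ℂ(1 ⊗ 1) ∈ Fᵖ H_ℂ`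
(Arapura §1: `Hodge(H) := Hom_MHS(ℚ(0), H)`). [cite: Arapura2022, §1 (p. 3)] -/
theorem Hom.apply_one_mem_hodgeClasses {H : MixedHodgeStructure V} (p : ℤ)
    (f : Hom (HodgeStructure.tate (-p)).toMixedHodgeStructure H) : f.toLinearMap 1 ∈ H.hodgeClasses p := by
  rw [mem_hodgeClasses_iff]
  refine ⟨f.map_W_le (2 * p) ⟨1, ?_, rfl⟩, ?_⟩
  · rw [HodgeStructure.toMixedHodgeStructure_W,
      HodgeStructure.trivialWeightFiltration_of_le (show -2 * -p ≤ 2 * p by omega)]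
    exact Submodule.mem_top
  · have h : ofRat (f.toLinearMap 1) = f.toLinearMap.baseChange ℂ ((1 : ℂ) ⊗ₜ[ℚ] (1 : ℚ)) := by
      rw [ofRat_apply, LinearMap.baseChange_tmul]
    rw [h]
    refine f.map_F_le p ⟨(1 : ℂ) ⊗ₜ[ℚ] (1 : ℚ), ?_, rfl⟩
    rw [HodgeStructure.toMixedHodgeStructure_F, HodgeStructure.tate_F,
      HodgeStructure.pureFiltration_of_le (show p ≤ -(-p) by omega)]
    exact Submodule.mem_top

/-- **A Hodge class `v` of type `(p, p)` defines the morphism `ℚ(-p) → H`, `q ↦ q • v`**: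
`W_k ℚ(-p) = 0` for `k < 2p` and `ℚ v ⊆ W_{2p} ⊆ W_k` for `k ≥ 2p`; `F^q ℚ(-p) = 0` for `q > p` and the
complexified image `ℂ (1 ⊗ v) ⊆ Fᵖ ⊆ F^q` for `q ≤ p` (Arapura §1). [cite: Arapura2022, §1 (p. 3)]
[cite: DeligneHodgeII1971, 2.1.13 and 2.3.1] -/
def Hom.ofHodgeClass (H : MixedHodgeStructure V) (p : ℤ) (v : H.hodgeClasses p) :
    Hom (HodgeStructure.tate (-p)).toMixedHodgeStructure H where
  toLinearMap := LinearMap.toSpanSingleton ℚ V (v : V)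
  map_W_le k := by
    rw [HodgeStructure.toMixedHodgeStructure_W]
    by_cases hk : k < -2 * -p
    · rw [HodgeStructure.trivialWeightFiltration_of_lt hk, Submodule.map_bot]
      exact bot_le
    · rintro _ ⟨q, -, rfl⟩
      rw [LinearMap.toSpanSingleton_apply]
      exact H.monotone_W (show 2 * p ≤ k by omega) (Submodule.smul_mem _ q (H.hodgeClasses_le_W p v.2))
  map_F_le q := by
    rw [HodgeStructure.toMixedHodgeStructure_F, HodgeStructure.tate_F]
    by_cases hq : q ≤ -(-p)
    · refine (LinearMap.map_le_range).trans ?_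
      rw [range_baseChange, ← LinearMap.span_singleton_eq_range, Submodule.baseChange_span,
        Set.image_singleton, Submodule.span_le, Set.singleton_subset_iff, TensorProduct.mk_apply]
      exact H.antitone_F (show q ≤ p by omega) ((H.mem_hodgeClasses_iff p v).1 v.2).2
    · rw [HodgeStructure.pureFiltration_of_lt (not_le.1 hq), Submodule.map_bot]
      exact bot_le

/-- The underlying map of `Hom.ofHodgeClass H p v` is `q ↦ q • v`. [cite: Arapura2022, §1 (p. 3)] -/
@[simp]
theorem Hom.ofHodgeClass_toLinearMap_apply (H : MixedHodgeStructure V) (p : ℤ) (v : H.hodgeClasses p)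
    (q : ℚ) : (Hom.ofHodgeClass H p v).toLinearMap q = q • (v : V) :=
  rfl

/-- **`Hom_MHS(ℚ(-p), H) ≃ Hdgᵖ(H)`, `f ↦ f(1)`** — Arapura's `Hodge(H(p)) = Hom_MHS(ℚ(0), H(p))
= Hom_MHS(ℚ(-p), H)` is the tree's `hodgeClasses H p` (inverse: `v ↦ (q ↦ q • v)`). [cite: Arapura2022, §1 (p. 3)]
[cite: DeligneHodgeII1971, 2.1.13 and 2.3.1] -/
def tateHomEquivHodgeClasses (H : MixedHodgeStructure V) (p : ℤ) :
    Hom (HodgeStructure.tate (-p)).toMixedHodgeStructure H ≃ H.hodgeClasses p where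
  toFun f := ⟨f.toLinearMap 1, Hom.apply_one_mem_hodgeClasses p f⟩
  invFun v := Hom.ofHodgeClass H p v
  left_inv f := Hom.ext (LinearMap.ext_ring (by
    rw [Hom.ofHodgeClass_toLinearMap_apply, one_smul]))
  right_inv v := Subtype.ext (by
    change (1 : ℚ) • (v : V) = v
    rw [one_smul])

/-- The class of `f : ℚ(-p) → H` is `f(1)`. [cite: Arapura2022, §1 (p. 3)] -/
@[simp]
theorem coe_tateHomEquivHodgeClasses_apply (H : MixedHodgeStructure V) (p : ℤ)
    (f : Hom (HodgeStructure.tate (-p)).toMixedHodgeStructure H) :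
    (tateHomEquivHodgeClasses H p f : V) = f.toLinearMap 1 :=
  rfl

/-- A morphism `ℚ(-p) → H` is determined by its value at `1`; it vanishes iff `f(1) = 0`.
[cite: Arapura2022, §1 (p. 3)] -/
theorem Hom.tate_eq_zero_iff {H : MixedHodgeStructure V} (p : ℤ)
    (f : Hom (HodgeStructure.tate (-p)).toMixedHodgeStructure H) :
    f = Hom.zero _ H ↔ f.toLinearMap 1 = 0 := by
  constructor
  · rintro rfl
    rfl
  · intro h
    exact Hom.ext (LinearMap.ext_ring (by rw [h]; rfl))

/-! ### `Hom_MHS(ℚ(0), Hom(H₁, H₂)) = Hom_MHS(H₁, H₂)` -/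

variable [FiniteDimensional ℚ V] [FiniteDimensional ℚ V'] (H₁ : MixedHodgeStructure V)
  (H₂ : MixedHodgeStructure V')

/-- **`Hom_MHS(ℚ(0), Hom(H₁, H₂)) ≃ Hom_MHS(H₁, H₂)`**, `f ↦ f(1)` (a morphism from the unit picks a
`(0,0)`-class of the internal Hom, i.e. a morphism `H₁ → H₂`): Deligne–Milne (1.6.4),
"`Hom(1, Hom(X, Y)) = Hom(1 ⊗ X, Y) = Hom(X, Y)`". [cite: DeligneMilne1982Tannakian, §1 (1.6.4)] -/
def unitHomHomEquiv : Hom (HodgeStructure.tate (-0)).toMixedHodgeStructure (hom H₁ H₂) ≃ Hom H₁ H₂ :=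
  (tateHomEquivHodgeClasses (hom H₁ H₂) 0).trans (homEquivHodgeClasses H₁ H₂).symm

/-- The morphism `H₁ → H₂` attached to `f : ℚ(0) → Hom(H₁, H₂)` has underlying map `f(1)`.
[cite: DeligneMilne1982Tannakian, §1 (1.6.4)] -/
@[simp]
theorem unitHomHomEquiv_apply_toLinearMap
    (f : Hom (HodgeStructure.tate (-0)).toMixedHodgeStructure (hom H₁ H₂)) :
    (unitHomHomEquiv H₁ H₂ f).toLinearMap = f.toLinearMap 1 :=
  rfl

/-- Conversely, the morphism `ℚ(0) → Hom(H₁, H₂)` attached to `φ : H₁ → H₂` is `q ↦ q • φ`.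
[cite: DeligneMilne1982Tannakian, §1 (1.6.4)] -/
@[simp]
theorem unitHomHomEquiv_symm_apply_toLinearMap (φ : Hom H₁ H₂) (q : ℚ) :
    ((unitHomHomEquiv H₁ H₂).symm φ).toLinearMap q = q • φ.toLinearMap :=
  rfl

end MixedHodgeStructure

end Literature.AlgebraicGeometry.Motives

end
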